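import Mathlib
import HarnessLib
import HarnessLib.Audit
import Summits.Langlands.Langlands.Theorems.CartanFiveSplit

/-!
# RelativeFifteenSplit — lens-5 g36 (kit 4): the Borel-`5` cells of `Residual37` on fields whose `15`-growth is
# QUADRATIC-INHERITED are EMPTY — the RELATIVE fifteen moduli door RFD (= g35's FMD relative to a subfield `F ⊆ K₀`;
# FMD ⟸ RFD), `j(E) ∈ F`, `[F:ℚ] ≤ 2 ⇒ [ℚ(j):ℚ] ≤ 2`, never in the residual range; `Residual37` ⟸ BOX13 ∧ RFD ∧ `Residual38`, EXACT

THESIS.  The residual of record is `Residual37` (tree decl `Summit.Langlands.Langlands.Theorems.CartanFiveSplit.Residual37`,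
p838303) = `NonSqrtFiveSector36 ∧ GrowthBorelFiveCell36 ∧ H8Cell36 ∧ H12Cell36`.  Its two BOREL pieces are cut here by ONE
predicate on the field: `QuadInherited K₀` := some subfield `F ⊆ K₀` with `[F:ℚ] ≤ 2` carries every `K₀`-point of Thorne's
models `E₁ ≅ X₀(15)` (15A1) and `E₂ ≅ X(s3,b5)` (15A3) — "the `15`-growth of `K₀` is absent or QUADRATIC-INHERITED".  The ONE
new junction is the RELATIVE form of g35's moduli door: **RFD** `RelativeFifteenDoor` — an integral `E / K₀` of shape
`(b3 ∨ s3⁺, b5)` defines a non-cuspidal `K₀`-point `P` of `X₀(15) ≅ E₁` or `X(s3,b5) ≅ E₂` with `j(P) = j(E)`; if `P ∈ E_i(F)`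
then `j(E) ∈ F`, because the `j`-map is defined over `ℚ` — VERBATIM the step «`E` determines an `F`-rational point of `Y` …»
of [Thorne2019, proof of Lemma 3] (there `F ⊂ ℚ_∞`; the step is field-agnostic) and of g35's FMD, which is RFD at `F = ⊥`
(`fifteenModuliDoor_of_relative`, PROVED).  KERNEL: `j ∈ F ⇒ ℚ⟮j⟯ ≤ F ⇒ [ℚ(j):ℚ] ≤ [F:ℚ] ≤ 2`
(`jDeg_le_finrank_of_mem`, Mathlib `IntermediateField.finrank_le_of_le_right`) ⇒ `¬ InResidualRange`
(g35's `not_inResidualRange_of_jDeg_le_two`): the quadratic-inherited Borel cells are EMPTY on BOTH sectors — on `√5 ∉ K₀`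
the `b5` shape of a non-modular curve is clause (ii) of BOX13 (`boxShape_of_box13`), on `√5 ∈ K₀` it is the Borel branch of
g36's C5D (already consumed upstream: `GrowthBorelFiveCell36` carries `BorelAt K₀ E 5`).  So
`Residual37` ⟸ BOX13 ∧ RFD ∧ `Residual38`, `Residual38 := GenuineNonSqrtFiveSector36 ∧ GenuineBorelFiveCell36 ∧ H8Cell36 ∧
H12Cell36` (the Borel pieces restricted to fields with GENUINE growth `¬ QuadInherited K₀`; the Cartan cells unchanged), EXACT
(`residual37_iff_residual38`).  BY NAME up the lineage the binder `hF : FifteenModuliDoor` is REPLACED by `hRFD :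
RelativeFifteenDoor` (FMD derived), `hR` becomes `Residual38`: same binder count, one junction generalised, residual weaker.

WHY THIS LINE.  Census-1's exact growth censuses (I-g33.3, I-g34.1: 332 + 155 real cyclic fields, `5 ∤ f`) measured that most
`15`-growth in even degree is QUADRATIC-INHERITED (cyclic sextics with `7 ∣ f`: 67 of the 100 growth fields grow only over the quadratic
subfield) and suggested «a RELATIVE-stability door X₀(15)(K₀) = X₀(15)(F)».  The box already exploits this where BASE CHANGE can: clause B5
of `UnanchoredBox` (TowerDoorSplit) removes `√5 ∉ K₀` fields that are `E₁`-stable over an anchor `F` of degree `≤ 5` with `K₀/F` GALOIS,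
SOLVABLE and of ODD degree (modularity over `F` + base change).  This node uses the same phenomenon WITHOUT base change — inside the
residual tower `j ∈ F` with `[F:ℚ] ≤ 2` is simply outside the residual RANGE (`jDeg ≤ 2`; g27's `JDegreeFilterSplit` routed small
`[ℚ(j):ℚ]` to NSBC) — so the parity / Galois / solvability conditions of B5 disappear and, above all, the door is valid ON the `√5`-sector,
where B5 is void (`¬ IsSquare 5` is its first conjunct) and I-g34.1 has no data (every field there has `5 ∣ f`; instrument I-g36.2 asked
23:57Z).  NEW COVERAGE, precisely: (i) every quadratic-inherited `√5`-field (e.g. `F = ℚ(√5)`: `K₀ = ℚ(√5, ζ₇+ζ₇⁻¹)` if `15a1`, `15a3` do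
not grow from `ℚ(√5)` to it); (ii) off `√5`, quadratic-inherited fields with `[K₀:F]` EVEN or `K₀/F` not Galois-solvable (degree `8`, `12`,
`16`, … over the quadratic subfield; composita `F·L` with `L` a non-Galois cubic) — cyclic sextics are B5's already.  Nearest tree prior
art: g35 `MordellWeilFifteenSplit` (FMD, `F = ℚ`), g36 `CartanFiveSplit` (`StableBorelFiveCell36`, `F = ℚ` on the `√5`-sector),
TowerDoorSplit B5 (anchor + base change) — DELTA: the anchor `F` is INSIDE the residual machinery (degree `≤ 2`, no modularity over `F`,
no base change, no parity), and stability is RELATIVE (`E_i(K₀) ⊆ E_i(F)`), on both sectors.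

RANKED CRUXES.  `Residual38` (rank 2; RESIDUAL, WEAKER, EXACT modulo BOX13 ∧ RFD): `GenuineNonSqrtFiveSector36` /
`GenuineBorelFiveCell36` = RES36's Borel-`5` part on fields where `E₁` or `E₂` acquires a point outside EVERY subfield of
degree `≤ 2` (census currency: «growth beyond quad.»; instrumentable per field by `2`-descent / exact twisted `L`-values
over the non-quadratic characters); `H8Cell36`, `H12Cell36` (g36, unchanged).  `RelativeFifteenDoor` (rank 3; PRINT
junction, binder; generalises FMD).

KILL CRITERIA.  An integral `E / K₀` with a `K₀`-rational `15`-isogeny (or `s3⁺ ∧ b5` structure) whose moduli point on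
`E₁` / `E₂` has coordinates in a subfield `F` but `j(E) ∉ F` — impossible in print (the `j`-map `X₀(15) → X(1)` is
`ℚ`-rational); would refute RFD as typed only through a mismatch between Thorne's models and the moduli problem
[Thorne2019, Prop. 4], the same exposure FMD already has.

NOT DECOMPOSED YET.  `GenuineBorelFiveCell36` on the `√5`-sector by the parity of `[K₀:ℚ(√5)]` (odd relative degree:
an `s3`-fibre argument à la SMD would need `X(s3,b5) → X₀(15)` degree-`2` geometry — not needed here since `E₂` itself is
elliptic); the Cartan cells (g36 NEXT-g37 (A2)).

CHEAPEST FALSIFIER.  I-g36.2 row `f = 35`: if `15a1`, `15a3` do not grow from `ℚ(√5)` to `ℚ(√5, ζ₇+ζ₇⁻¹)`, the smallest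
doubly-entangled field has NO Borel-`5` candidates in the residual range (this node) and its residual is the four Cartan
curves (g36).

HONEST STATUS.  CONDITIONAL node: RFD is a PRINT junction (binder, credits nothing; not in the tree — no moduli
interpretation of `X₀(15)` is vendored), exactly as FMD which it implies; BOX13 = `Box2022_theorem1_3` (named fact) supplies
the shape off the `√5`-sector.  Nothing here proves a curve modular; the closed cells are EMPTY.  Count-neutral NODE.

References: [Thorne2019] J. Thorne, "Elliptic curves over ℚ_∞ are modular", JEMS 21 (2019) = arXiv:1505.04769 — Lemma 3
and its proof, Prop. 4 (models `E₁ = 15A1 ≅ X₀(15)`, `E₂ = 15A3 ≅ X(s3,b5)`); [FreitasLeHungSiksek2015] arXiv:1310.7088,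
§5 (the curves `X(b5)`, `X(b3,b5)`, `X(s3,b5)`); [Box2022] arXiv:2103.13975, Thm. 1.3; census-1 I-g34.1
(HOME/census/data/gen_v34/I-g34-1/I-g34-1.md: the quadratic-inherited columns).
-/

set_option linter.dupNamespace false -- project-wide option; `Summit.Langlands.Langlands` is the mandated namespace

open scoped NumberField IntermediateField MatrixGroups
open NumberField Field Literature.NumberTheory.Automorphic
open Literature.NumberTheory.GaloisRepresentations
open Summit.Langlands.Langlands.Theorems.DepthIsolationSplit (UnanchoredBox IntegralModelTransferPointwise)
open Summit.Langlands.Langlands.Theorems.JDegreeFilterSplit (jInv jDeg InResidualRange RatBaseChangeModularity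
  SmallFieldBaseChange)
open Summit.Langlands.Langlands.Theorems.DyadicDoorSplit (AllenLocus AllenDyadicCorollary)
open Summit.Langlands.Langlands.Theorems.OddPrimeDoorSplit (OffDoors SkinnerWilesDihedralDoor PanZhangSupersingularDoor)
open Summit.Langlands.Langlands.Theorems.RealCyclotomicDoorSplit (BorelAt BorelOrSplitCartanThree BoxShape boxShape_of_box13)
open Summit.Langlands.Langlands.Theorems.ReductionSignatureSplit (OffSignatureDoors NearlyOrdinaryDihedralDoorThree
  SplitOrdinaryDihedralDoor MixedSignatureDoor)
open Summit.Langlands.Langlands.Theorems.NearlyOrdinaryDistinguishedSplit (OnNODDoor NearlyOrdinaryDistinguishedDoor)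
open Summit.Langlands.Langlands.Theorems.MordellWeilFifteenSplit (FifteenStable Growth FifteenModuliDoor)
open Summit.Langlands.Langlands.Theorems.MordellWeilSevenSplit (SevenGrowth SevenModuliDoor Residual36
  not_inResidualRange_of_jDeg_le_two)
open Summit.Langlands.Langlands.Theorems.CartanFiveSplit (H8At H12At CartanFiveDoor NonSqrtFiveSector36 GrowthBorelFiveCell36
  H8Cell36 H12Cell36 Residual37 residual36_of_pieces cartanFiveDoor_of_FLS2015_theorem3)

namespace Summit.Langlands.Langlands.Theorems.RelativeFifteenSplit

/-! ## §1 The dial: RELATIVE Mordell–Weil stability of `E₁ ≅ X₀(15)`, `E₂ ≅ X(s3,b5)` with respect to a subfield `F ⊆ K₀` -/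

/-- "`W(K₀) ⊆ W(F)`": every `K₀`-rational affine point of the rational Weierstrass curve `W` has both coordinates in the
subfield `F ⊆ K₀` (at `F = ⊥` this is `Thorne2019.PointsRational W K₀`, `pointsIn_bot_iff`). -/
def PointsIn (W : WeierstrassCurve ℚ) (K₀ : Type) [Field K₀] [NumberField K₀] (F : IntermediateField ℚ K₀) : Prop :=
  ∀ x y : K₀, (W.baseChange K₀).toAffine.Equation x y → x ∈ F ∧ y ∈ F

/-- RELATIVE FIFTEEN-STABILITY of `K₀` over the subfield `F`: no Mordell–Weil growth of `E₁ = 15A1` and `E₂ = 15A3` from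
`F` to `K₀`. -/
def RelFifteenStable (K₀ : Type) [Field K₀] [NumberField K₀] (F : IntermediateField ℚ K₀) : Prop :=
  PointsIn Thorne2019.E₁ K₀ F ∧ PointsIn Thorne2019.E₂ K₀ F

/-- QUADRATIC-INHERITED `15`-growth: some subfield `F ⊆ K₀` of degree `≤ 2` over `ℚ` carries all `K₀`-points of `E₁` and
`E₂` (includes `15`-STABLE: `F = ⊥`, `quadInherited_of_fifteenStable`). -/
def QuadInherited (K₀ : Type) [Field K₀] [NumberField K₀] : Prop :=
  ∃ F : IntermediateField ℚ K₀, Module.finrank ℚ F ≤ 2 ∧ RelFifteenStable K₀ F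

/-- At `F = ⊥` relative stability is g35's absolute stability. -/
theorem pointsIn_bot_iff (W : WeierstrassCurve ℚ) (K₀ : Type) [Field K₀] [NumberField K₀] :
    PointsIn W K₀ ⊥ ↔ Thorne2019.PointsRational W K₀ := by
  simp only [PointsIn, Thorne2019.PointsRational, IntermediateField.mem_bot]

/-- `RelFifteenStable K₀ ⊥ ↔ FifteenStable K₀`. -/
theorem relFifteenStable_bot_iff (K₀ : Type) [Field K₀] [NumberField K₀] :
    RelFifteenStable K₀ ⊥ ↔ FifteenStable K₀ := by
  simp only [RelFifteenStable, FifteenStable, pointsIn_bot_iff]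

/-- Relative stability is monotone in the subfield. -/
theorem pointsIn_mono {W : WeierstrassCurve ℚ} {K₀ : Type} [Field K₀] [NumberField K₀] {F F' : IntermediateField ℚ K₀}
    (h : F ≤ F') (hW : PointsIn W K₀ F) : PointsIn W K₀ F' :=
  fun x y hxy => ⟨h (hW x y hxy).1, h (hW x y hxy).2⟩

/-- `15`-stable fields are quadratic-inherited (with `F = ⊥`, `[⊥:ℚ] = 1`). -/
theorem quadInherited_of_fifteenStable {K₀ : Type} [Field K₀] [NumberField K₀] (h : FifteenStable K₀) :
    QuadInherited K₀ :=
  ⟨⊥, by rw [IntermediateField.finrank_bot]; norm_num, (relFifteenStable_bot_iff K₀).mpr h⟩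

/-- Genuine growth excludes stability. -/
theorem not_fifteenStable_of_not_quadInherited {K₀ : Type} [Field K₀] [NumberField K₀] (h : ¬ QuadInherited K₀) :
    ¬ FifteenStable K₀ :=
  fun hst => h (quadInherited_of_fifteenStable hst)

/-! ## §2 The ONE new print junction RFD, and FMD ⟸ RFD -/

/-- **RFD — RELATIVE FIFTEEN MODULI DOOR** (PRINT junction; binder, credits nothing).  An integral `E / K₀` with a
Borel-or-`C_s⁺(3)` framing of `E[3]` and a Borel framing of `E[5]` defines a NON-CUSPIDAL `K₀`-point `P` of `X₀(15) ≅ E₁` or of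
`X(s3,b5) ≅ E₂` with `j(P) = j(E)` [Thorne2019, before Lemma 3; FreitasLeHungSiksek2015, §5]; if every `K₀`-point of `E₁` and of
`E₂` has coordinates in the subfield `F`, then so does `P`, and `j(E) = j(P) ∈ F` because the `j`-map `X → X(1)` is defined over
`ℚ` — the step «`E` determines an `F`-rational point … hence `j ∈ F`» of [Thorne2019, proof of Lemma 3 (2)] for an ARBITRARY
subfield `F` (g35's FMD is the case `F = ⊥`, `fifteenModuliDoor_of_relative`).  NOT in the tree (no moduli interpretation of
`X₀(15)` is vendored). [ref: Thorne2019, Lemma 3 and Prop. 4] [ref: FreitasLeHungSiksek2015, §5] -/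
def RelativeFifteenDoor : Prop :=
  ∀ (K₀ : Type) [Field K₀] [NumberField K₀] (F : IntermediateField ℚ K₀) (E : WeierstrassCurve (𝓞 K₀)), E.Δ ≠ 0 →
    BorelOrSplitCartanThree K₀ E → BorelAt K₀ E 5 → RelFifteenStable K₀ F → jInv K₀ E ∈ F

/-- **FMD ⟸ RFD** (PROVED; `F = ⊥` and `IntermediateField.mem_bot`): g35's binder is the absolute case of this node's. -/
theorem fifteenModuliDoor_of_relative (h : RelativeFifteenDoor) : FifteenModuliDoor := by
  intro K₀ _ _ E hΔ h3 hb5 hst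
  have hj : jInv K₀ E ∈ (⊥ : IntermediateField ℚ K₀) := h K₀ ⊥ E hΔ h3 hb5 ((relFifteenStable_bot_iff K₀).mpr hst)
  rw [IntermediateField.mem_bot] at hj
  obtain ⟨q, hq⟩ := hj
  exact ⟨q, by rw [← hq]; rfl⟩

/-- KERNEL: `j ∈ F ⇒ [ℚ(j):ℚ] ≤ [F:ℚ]` (`ℚ⟮j⟯ ≤ F`). -/
theorem jDeg_le_finrank_of_mem {K₀ : Type} [Field K₀] [NumberField K₀] (E : WeierstrassCurve (𝓞 K₀))
    (F : IntermediateField ℚ K₀) (hj : jInv K₀ E ∈ F) : jDeg K₀ E ≤ Module.finrank ℚ F :=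
  IntermediateField.finrank_le_of_le_right (IntermediateField.adjoin_simple_le_iff.mpr hj)

/-- THE DOOR MECHANISM: over a quadratic-inherited `K₀`, a curve of shape `(b3 ∨ s3⁺, b5)` has `[ℚ(j):ℚ] ≤ 2`, hence is NOT in
the residual range.  No base change, no modularity over `F`. -/
theorem not_inResidualRange_of_quadInherited (hR : RelativeFifteenDoor) {K₀ : Type} [Field K₀] [NumberField K₀]
    (hq : QuadInherited K₀) {E : WeierstrassCurve (𝓞 K₀)} (hΔ : E.Δ ≠ 0) (h3 : BorelOrSplitCartanThree K₀ E)
    (hb5 : BorelAt K₀ E 5) : ¬ InResidualRange K₀ E := by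
  obtain ⟨F, hF2, hst⟩ := hq
  exact not_inResidualRange_of_jDeg_le_two ((jDeg_le_finrank_of_mem E F (hR K₀ F E hΔ h3 hb5 hst)).trans hF2)

/-! ## §3 The pieces of `Residual37` by quadratic inheritance -/

/-- QUADRATIC-INHERITED BOREL CELL off the `√5`-sector (CLOSED — empty — from BOX13 ∧ RFD; the shape comes from BOX13 (i),(ii)). -/
def QuadInheritedNonSqrtFiveCell36 : Prop :=
  ∀ (K₀ : Type) [Field K₀] [NumberField K₀], UnanchoredBox K₀ → Growth K₀ → SevenGrowth K₀ → ¬ IsSquare (5 : K₀) →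
    QuadInherited K₀ →
    ∀ E : WeierstrassCurve (𝓞 K₀), E.Δ ≠ 0 → InResidualRange K₀ E → ¬ AllenLocus K₀ E → OffDoors K₀ E →
      OffSignatureDoors K₀ E → ¬ OnNODDoor K₀ E → IsModularEllipticCurve K₀ E

/-- GENUINE-GROWTH sector off `√5` (RESIDUAL): `NonSqrtFiveSector36` on fields whose `15`-growth is NOT quadratic-inherited. -/
def GenuineNonSqrtFiveSector36 : Prop :=
  ∀ (K₀ : Type) [Field K₀] [NumberField K₀], UnanchoredBox K₀ → Growth K₀ → SevenGrowth K₀ → ¬ IsSquare (5 : K₀) →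
    ¬ QuadInherited K₀ →
    ∀ E : WeierstrassCurve (𝓞 K₀), E.Δ ≠ 0 → InResidualRange K₀ E → ¬ AllenLocus K₀ E → OffDoors K₀ E →
      OffSignatureDoors K₀ E → ¬ OnNODDoor K₀ E → IsModularEllipticCurve K₀ E

/-- QUADRATIC-INHERITED BOREL-`5` CELL of the `√5`-sector (CLOSED — empty — from RFD alone; the shape is a hypothesis). -/
def QuadInheritedBorelFiveCell36 : Prop :=
  ∀ (K₀ : Type) [Field K₀] [NumberField K₀], UnanchoredBox K₀ → Growth K₀ → SevenGrowth K₀ → IsSquare (5 : K₀) →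
    QuadInherited K₀ →
    ∀ E : WeierstrassCurve (𝓞 K₀), E.Δ ≠ 0 → InResidualRange K₀ E → ¬ AllenLocus K₀ E → OffDoors K₀ E →
      OffSignatureDoors K₀ E → ¬ OnNODDoor K₀ E → BorelOrSplitCartanThree K₀ E → BorelAt K₀ E 5 →
        IsModularEllipticCurve K₀ E

/-- GENUINE-GROWTH BOREL-`5` CELL of the `√5`-sector (RESIDUAL): `GrowthBorelFiveCell36` on fields with genuine growth. -/
def GenuineBorelFiveCell36 : Prop :=
  ∀ (K₀ : Type) [Field K₀] [NumberField K₀], UnanchoredBox K₀ → Growth K₀ → SevenGrowth K₀ → IsSquare (5 : K₀) →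
    ¬ QuadInherited K₀ →
    ∀ E : WeierstrassCurve (𝓞 K₀), E.Δ ≠ 0 → InResidualRange K₀ E → ¬ AllenLocus K₀ E → OffDoors K₀ E →
      OffSignatureDoors K₀ E → ¬ OnNODDoor K₀ E → BorelOrSplitCartanThree K₀ E → BorelAt K₀ E 5 →
        IsModularEllipticCurve K₀ E

/-- **Residual38 — THE DECLARED RESIDUAL** (WEAKER than `Residual37`; EXACT modulo BOX13 ∧ RFD): the two Borel pieces on
GENUINE-growth fields and g36's two Cartan cells. -/
def Residual38 : Prop :=
  GenuineNonSqrtFiveSector36 ∧ GenuineBorelFiveCell36 ∧ H8Cell36 ∧ H12Cell36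

/-! ## §4 Kernel: the quadratic-inherited Borel cells are empty; `Residual37` from the pieces; exactness -/

/-- **The quadratic-inherited cell OFF `√5` is CLOSED** (empty): a non-modular candidate has shape `(b3 ∨ s3⁺)` and — as
`√5 ∉ K₀` — `b5` by BOX13; RFD puts `j` in a field of degree `≤ 2`; contradiction with the residual range. -/
theorem quadInheritedNonSqrtFiveCell36_closed (hB : Box2022_theorem1_3) (hR : RelativeFifteenDoor) :
    QuadInheritedNonSqrtFiveCell36 := by
  intro K₀ _ _ hU _ _ h5 hq E hΔ hr _ _ _ _
  haveI : IsTotallyReal K₀ := hU.1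
  by_contra hne
  have hshape : BoxShape K₀ E :=
    boxShape_of_box13 hB K₀ E hΔ (not_isAutomorphicOfWeightZero_of_not_isModularEllipticCurve hΔ hne)
  exact not_inResidualRange_of_quadInherited hR hq hΔ hshape.1 (hshape.2.1 h5) hr

/-- **The quadratic-inherited Borel-`5` cell ON `√5` is CLOSED** (empty; RFD alone). -/
theorem quadInheritedBorelFiveCell36_closed (hR : RelativeFifteenDoor) : QuadInheritedBorelFiveCell36 := by
  intro K₀ _ _ _ _ _ _ hq E hΔ hr _ _ _ _ h3 hb5
  exact absurd hr (not_inResidualRange_of_quadInherited hR hq hΔ h3 hb5)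

/-- `Residual37 → Residual38` (each Borel piece is the old one with an extra hypothesis; Cartan cells unchanged). -/
theorem residual38_of_residual37 (h : Residual37) : Residual38 :=
  ⟨fun K₀ _ _ hU hG hS h5 _ E hΔ hr hA hO hSig hN => h.1 K₀ hU hG hS h5 E hΔ hr hA hO hSig hN,
    fun K₀ _ _ hU hG hS h5 hq E hΔ hr hA hO hSig hN h3 hb =>
      h.2.1 K₀ hU hG hS h5 (not_fifteenStable_of_not_quadInherited hq) E hΔ hr hA hO hSig hN h3 hb,
    h.2.2.1, h.2.2.2⟩

/-- **`Residual37` from the pieces**: BOX13 ∧ RFD ∧ `Residual38` ⇒ `Residual37`. -/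
theorem residual37_of_pieces38 (hB : Box2022_theorem1_3) (hR : RelativeFifteenDoor) (h : Residual38) : Residual37 := by
  refine ⟨?_, ?_, h.2.2.1, h.2.2.2⟩
  · intro K₀ _ _ hU hG hS h5 E hΔ hr hA hO hSig hN
    by_cases hq : QuadInherited K₀
    · exact quadInheritedNonSqrtFiveCell36_closed hB hR K₀ hU hG hS h5 hq E hΔ hr hA hO hSig hN
    · exact h.1 K₀ hU hG hS h5 hq E hΔ hr hA hO hSig hN
  · intro K₀ _ _ hU hG hS h5 _ E hΔ hr hA hO hSig hN h3 hb
    by_cases hq : QuadInherited K₀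
    · exact quadInheritedBorelFiveCell36_closed hR K₀ hU hG hS h5 hq E hΔ hr hA hO hSig hN h3 hb
    · exact h.2.1 K₀ hU hG hS h5 hq E hΔ hr hA hO hSig hN h3 hb

/-- **EXACTNESS**: modulo BOX13 ∧ RFD, `Residual37 ↔ Residual38`. -/
theorem residual37_iff_residual38 (hB : Box2022_theorem1_3) (hR : RelativeFifteenDoor) : Residual37 ↔ Residual38 :=
  ⟨residual38_of_residual37, residual37_of_pieces38 hB hR⟩

/-- Two storeys: RES36 ⟸ BOX13 ∧ C5D ∧ RFD ∧ `Residual38` (FMD is DERIVED from RFD). -/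
theorem residual36_of_pieces38 (hB : Box2022_theorem1_3) (hD : CartanFiveDoor) (hR : RelativeFifteenDoor)
    (h : Residual38) : Residual36 :=
  residual36_of_pieces hD (fifteenModuliDoor_of_relative hR) (residual37_of_pieces38 hB hR h)

/-- RES36 under the named facts `Box2022_theorem1_3`, `FLS2015_theorem3` and the binder RFD. [cite: FreitasLeHungSiksek2015, Thm. 3] -/
theorem residual36_of_FLS2015_theorem3 (hB : Box2022_theorem1_3) (h3 : FLS2015_theorem3) (hR : RelativeFifteenDoor)
    (h : Residual38) : Residual36 :=
  residual36_of_pieces38 hB (cartanFiveDoor_of_FLS2015_theorem3 h3) hR h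

/-! ## §5 BY NAME up the lineage: binder `FifteenModuliDoor` REPLACED by `RelativeFifteenDoor`, residual `Residual38` -/

/-- **REST (stmt-Langlands-26998) BY NAME**: g36's `CartanFiveSplit.closes_byName` with `hF : FifteenModuliDoor` replaced by
`hRFD : RelativeFifteenDoor` (FMD derived in-kernel) and `hR : Residual38`; same number of binders.  CONDITIONAL display via
`closure.modulo`; credits nothing. -/
theorem closes_byName (hDBC : RatBaseChangeModularity) (hNSBC : SmallFieldBaseChange)
    (hFLS : FLS2015_theorem1) (hDNS : DNS2020_theorem4) (hBox : Box2022_theorem1_1)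
    (hADC : AllenDyadicCorollary) (h34 : FLS2015_theorems3_4) (hSW : SkinnerWilesDihedralDoor)
    (hPZ : PanZhangSupersingularDoor) (hNO3 : NearlyOrdinaryDihedralDoorThree) (hNOS : SplitOrdinaryDihedralDoor)
    (hMIX : MixedSignatureDoor) (hNOD : NearlyOrdinaryDistinguishedDoor) (hB : Box2022_theorem1_3)
    (hRFD : RelativeFifteenDoor) (hS : SevenModuliDoor) (hR : Residual38)
    (hIMT : IntegralModelTransferPointwise)
    (hTr : Summit.Langlands.Langlands.Theses.EllipticDegreeLadder.EllipticTransportAnyBase)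
    (hW : Summit.Langlands.Langlands.Theses.EllipticDegreeLadder.SatakeAvatarExistence)
    (h1 : Summit.Langlands.Langlands.Theses.EllipticDegreeLadder.RankOneAutomorphy) :
    Summit.Langlands.Langlands.Theses.TowerDoorSplit.UnanchoredHighDegreeWitnessAutomorphy :=
  Summit.Langlands.Langlands.Theorems.CartanFiveSplit.closes_byName hDBC hNSBC hFLS hDNS hBox hADC h34 hSW hPZ hNO3 hNOS
    hMIX hNOD hB (fifteenModuliDoor_of_relative hRFD) hS (residual37_of_pieces38 hB hRFD hR) hIMT hTr hW h1

/-! ## §6 One storey up: the field-level form -/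

/-- **Over a totally real `K₀` with quadratic-inherited `15`-growth, a NON-modular `E` of shape `(b3 ∨ s3⁺, b5)` has
`[ℚ(j):ℚ] ≤ 2`** — so off the `√5`-sector (shape automatic by BOX13) every non-modular curve has `[ℚ(j):ℚ] ≤ 2`, and on the
`√5`-sector every non-modular curve has `[ℚ(j):ℚ] ≤ 2` or lives on a Cartan curve `X(u3,H8)`, `X(u3,H12)` (with g36's C5D). -/
theorem jDeg_le_two_or_cartan_of_not_modular (hB : Box2022_theorem1_3) (hD : CartanFiveDoor) (hR : RelativeFifteenDoor)
    (K₀ : Type) [Field K₀] [NumberField K₀] (hK : IsTotallyReal K₀) (hq : QuadInherited K₀)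
    (E : WeierstrassCurve (𝓞 K₀)) (hΔ : E.Δ ≠ 0) (hne : ¬ IsModularEllipticCurve K₀ E) :
    jDeg K₀ E ≤ 2 ∨ (BorelOrSplitCartanThree K₀ E ∧ (H8At K₀ E ∨ H12At K₀ E)) := by
  obtain ⟨F, hF2, hst⟩ := hq
  by_cases h5 : IsSquare (5 : K₀)
  · obtain ⟨h3, hb | h8 | h12⟩ := hD K₀ hK h5 E hΔ hne
    · exact Or.inl ((jDeg_le_finrank_of_mem E F (hR K₀ F E hΔ h3 hb hst)).trans hF2)
    · exact Or.inr ⟨h3, Or.inl h8⟩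
    · exact Or.inr ⟨h3, Or.inr h12⟩
  · haveI := hK
    have hshape : BoxShape K₀ E :=
      boxShape_of_box13 hB K₀ E hΔ (not_isAutomorphicOfWeightZero_of_not_isModularEllipticCurve hΔ hne)
    exact Or.inl ((jDeg_le_finrank_of_mem E F (hR K₀ F E hΔ hshape.1 (hshape.2.1 h5) hst)).trans hF2)

end Summit.Langlands.Langlands.Theorems.RelativeFifteenSplit
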